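import Mathlib
import Literature.Topology.FourManifolds.ProfiniteDetectionSumS1S2
import Literature.Topology.FourManifolds.ProfiniteDetectionSumS1S2Proofs
import Literature.Topology.FourManifolds.AsphericalThreeManifoldGroupNotProjective
import Literature.Topology.FourManifolds.KneserMilnorRetract
import Summits.SmoothPoincare4.SmoothPoincare4.Theses.CongruenceShadows
import Summits.SmoothPoincare4.SmoothPoincare4.Theorems.CongruenceShadowsHeegaardPairFreenessDetectionStubSubsingletonOfIsCyclic
import Summits.SmoothPoincare4.SmoothPoincare4.Theorems.CongruenceShadowsHeegaardPairFreenessDetectionStubLiftOfFiniteIndex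

/-!
# Crux `HeegaardPairFreenessDetection` (stmt-SmoothPoincare4-15157), line `Sketch`, composition
# `projective-retract-sieve` — the lead's skeleton

The crux: for `K₁, K₂ ≤ S_g` with `S_g ⧸ ⟪Kᵢ⟫` free of rank `g`, if the pair quotient
`G = S_g ⧸ ⟪K₁ ∪ K₂⟫` has exactly the finite quotients of `F_k`, then `G` is free of rank `k`.

The sieve (idea card `projective-retract-sieve`): "same finite quotients as `F_k`" makes every finite
embedding problem for `G` weakly solvable (tree:
`exists_monoidHom_comp_eq_of_sameFiniteQuotients_freeGroup`); this LIFTING PROPERTY (the finite shadow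
of "`Ĝ` is projective") passes to retracts and — the hard stub — to finite-index subgroups; no
non-trivial finite group has it (pass to a cyclic subgroup: `ℤ/n` does not lift through `ℤ/n² ↠ ℤ/n`);
no closed aspherical 3-manifold group has it (named fact F2, goodness); so by Kneser–Milnor in retract
form (named fact F1) the closed 3-manifold group `G = π₁(H₁ ∪ H₂)` (named fact: the tree's Jaco–Hempel
bridge `exists_closedThreeManifold_fundamentalGroup_pairQuotient`) is free of some rank, and rank
detection (tree: `IsFreeOfRank.of_sameFiniteQuotients`) pins the rank to `k`.

Stubs.  Group theory (stated with the lifting property UNFOLDED; both LANDED as pure-proof files and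
imported here): `stub_liftOfFiniteIndex` — the lifting property passes to finite-index subgroups
(coinduction to the permutation wreath product `(G/V → E) ⋊ Sym(G/V)`); `stub_subsingleton_of_isCyclic`
— a finite cyclic group with the lifting property is trivial.  Named facts (the line's literature
debt — three Literature named facts, all VENDORED and undischarged; sorried `stub_*` below until
their `_holds` land): F1 `stub_kneserMilnorRetract : kneserMilnor_retract_alternative`
(KneserMilnorRetract.lean, p97180), F2 `stub_asphericalNotLift : not_lift_fundamentalGroup_of_aspherical`
(AsphericalThreeManifoldGroupNotProjective.lean, p96982), B `stub_heegaardRealisation :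
exists_heegaardSplitting_realizing_kernels` (HeegaardSplittingRealization.lean, Jaco's realisation
lemma).
Composition (proved here): `subsingleton_of_finite_of_lift`, `lift_of_retract`, `lift_of_mulEquiv`,
`HeegaardPairFreenessDetection_of`.
-/

noncomputable section

-- the prescribed namespace `Summit.<P>.<Sub>.…` duplicates `SmoothPoincare4` (P = Sub)
set_option linter.dupNamespace false

namespace Summit.SmoothPoincare4.SmoothPoincare4.Theorems.HeegaardPairFreenessDetection.Sieve

open Literature.Topology.FourManifolds Subgroup
open scoped Manifold ContDiff

universe u

/-! ## Registered stubs (finite group theory) — LANDED, imported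

* `stub_liftOfFiniteIndex` — Theorems/CongruenceShadowsHeegaardPairFreenessDetectionStubLiftOfFiniteIndex.lean (p96577)
* `stub_subsingleton_of_isCyclic` — Theorems/CongruenceShadowsHeegaardPairFreenessDetectionStubSubsingletonOfIsCyclic.lean (p96393)
-/

/-! ## Group-theoretic composition -/

/-- **No non-trivial finite group has the lifting property**: for `a ∈ A`, the cyclic subgroup `⟨a⟩`
has finite index, inherits the lifting property (`stub_liftOfFiniteIndex`) and is therefore trivial
(`stub_subsingleton_of_isCyclic`), so `a = 1`. [folklore] -/
theorem subsingleton_of_finite_of_lift {A : Type u} [Group A] [Finite A]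
    (hA : ∀ (P E : Type) [Group P] [Finite P] [Group E] [Finite E] (π : A →* P) (ε : E →* P),
      Function.Surjective ε → ∃ f : A →* E, ε.comp f = π) : Subsingleton A := by
  refine subsingleton_of_forall_eq 1 fun a => ?_
  haveI : Subsingleton (zpowers a) :=
    stub_subsingleton_of_isCyclic (stub_liftOfFiniteIndex (zpowers a) hA)
  have h : (⟨a, mem_zpowers a⟩ : zpowers a) = 1 := Subsingleton.elim _ _
  exact congrArg Subtype.val h

/-- The lifting property passes to retracts: if `ρ ∘ s = id_B` and `G` lifts, so does `B` (compose the
problem with `ρ`, restrict the solution along `s`). [folklore] -/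
theorem lift_of_retract {G : Type u} {B : Type} [Group G] [Group B] (ρ : G →* B) (s : B →* G)
    (hρs : ∀ b, ρ (s b) = b)
    (hG : ∀ (P E : Type) [Group P] [Finite P] [Group E] [Finite E] (π : G →* P) (ε : E →* P),
      Function.Surjective ε → ∃ f : G →* E, ε.comp f = π)
    (P E : Type) [Group P] [Finite P] [Group E] [Finite E] (π : B →* P) (ε : E →* P)
    (hε : Function.Surjective ε) : ∃ f : B →* E, ε.comp f = π := by
  obtain ⟨f, hf⟩ := hG P E (π.comp ρ) ε hε
  refine ⟨f.comp s, MonoidHom.ext fun b => ?_⟩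
  have := DFunLike.congr_fun hf (s b)
  simpa [hρs] using this

/-- The lifting property is transported along isomorphisms. [folklore] -/
theorem lift_of_mulEquiv {B B' : Type} [Group B] [Group B'] (e : B ≃* B')
    (hB : ∀ (P E : Type) [Group P] [Finite P] [Group E] [Finite E] (π : B →* P) (ε : E →* P),
      Function.Surjective ε → ∃ f : B →* E, ε.comp f = π)
    (P E : Type) [Group P] [Finite P] [Group E] [Finite E] (π : B' →* P) (ε : E →* P)
    (hε : Function.Surjective ε) : ∃ f : B' →* E, ε.comp f = π := by
  obtain ⟨f, hf⟩ := hB P E (π.comp e.toMonoidHom) ε hε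
  refine ⟨f.comp e.symm.toMonoidHom, MonoidHom.ext fun x => ?_⟩
  have := DFunLike.congr_fun hf (e.symm x)
  simpa using this

/-! ## Fact stubs (the line's honest literature debt: closed only when the named facts land and are
discharged; see `## Census` — What is missing) -/

/-- **Stub F1** — Kneser–Milnor in retract form: the tree's NAMED FACT
`Literature.Topology.FourManifolds.kneserMilnor_retract_alternative` (universe `0`;
KneserMilnorRetract.lean, landed p97180: Kneser 1929 / Milnor 1962, Hempel Thm. 3.15, Lemma 3.13,
Lemma 3.2; Aschenbrenner–Friedl–Wilton Thm. 1.1 and (C.1) — Sphere Theorem + Hurewicz; Perelman is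
not used), undischarged; not provable inside the tree today.  The stub closes when its `_holds`
lands. -/
theorem stub_kneserMilnorRetract :
    Literature.Topology.FourManifolds.kneserMilnor_retract_alternative.{0} := by
  sorry

/-- **Stub F2** — closed aspherical 3-manifold groups lack the lifting property: the tree's NAMED
FACT `Literature.Topology.FourManifolds.not_lift_fundamentalGroup_of_aspherical` (universe `0`;
AsphericalThreeManifoldGroupNotProjective.lean, landed p96982: goodness of 3-manifold groups,
Aschenbrenner–Friedl–Wilton (G.24), (H.5), Prop. 9.29; Serre I §3.4 Prop. 16, I §5.9 Prop. 45 and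
Cor. 2 — Perelman + Agol–Wise inside), undischarged; not provable inside the tree today.  The stub
closes when its `_holds` lands. -/
theorem stub_asphericalNotLift :
    Literature.Topology.FourManifolds.not_lift_fundamentalGroup_of_aspherical.{0} := by
  sorry

/-- **Stub B** — Jaco's realisation lemma (Hempel Lemma 14.5 = Jaco 1969): every pair of
handlebody kernels of genus `g ≥ 2` is the kernel pair of a Heegaard splitting of a closed orientable
3-manifold.  This is the tree's EXISTING named fact
`Literature.Topology.FourManifolds.exists_heegaardSplitting_realizing_kernels`
(HeegaardSplittingRealization.lean), undischarged (reduced in HeegaardSplittingRealizationProofs.lean to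
Leininger–Reid Lemma 2.2 / Grigorchuk–Kurchanov + Dehn–Nielsen–Baer, all named facts); from it the
tree PROVES the bridge `exists_closedThreeManifold_fundamentalGroup_pairQuotient` (van Kampen +
stabilisation, `exists_closedThreeManifold_fundamentalGroup_pairQuotient_of_realization`).  The stub
closes when its `_holds` lands. -/
theorem stub_heegaardRealisation : exists_heegaardSplitting_realizing_kernels.{0} := by
  sorry

/-! ## The composition: the sieve concludes the crux by name -/

/-- **The projective-retract sieve closes the crux modulo its stubs.**  From F1
(`stub_kneserMilnorRetract`), F2 (`stub_asphericalNotLift`) and Jaco's realisation lemma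
(`stub_heegaardRealisation`, through the tree's proved van Kampen bridge
`exists_closedThreeManifold_fundamentalGroup_pairQuotient_of_realization`): the pair quotient is
`π₁(Y, y)` of a closed orientable 3-manifold;
it has the lifting property (`exists_monoidHom_comp_eq_of_sameFiniteQuotients_freeGroup`); a
non-trivial finite retract is impossible (`subsingleton_of_finite_of_lift`, from the two group-theory
stubs), an aspherical retract is impossible (F2); so `π₁(Y, y)` is free of some rank (F1) and rank
detection (`IsFreeOfRank.of_sameFiniteQuotients`) gives rank `k`. -/
theorem HeegaardPairFreenessDetection_of :
    Summit.SmoothPoincare4.SmoothPoincare4.Theses.CongruenceShadows.HeegaardPairFreenessDetection := by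
  intro g k K₁ K₂ hK₁ hK₂ hQ
  obtain ⟨Y, _, _, _, _, _, _, _, hY, y, ⟨e⟩⟩ :=
    exists_closedThreeManifold_fundamentalGroup_pairQuotient_of_realization
      stub_heegaardRealisation g K₁ K₂ hK₁ hK₂
  have hQ' : ∀ (Q : Type) [Group Q] [Finite Q],
      (∃ f : FundamentalGroup Y y →* Q, Function.Surjective f) ↔
        (∃ f : FreeGroup (Fin k) →* Q, Function.Surjective f) := fun Q _ _ =>
    (exists_surjective_monoidHom_iff_of_mulEquiv e).trans (hQ Q)
  have hlift : ∀ (P E : Type) [Group P] [Finite P] [Group E] [Finite E]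
      (π : FundamentalGroup Y y →* P) (ε : E →* P), Function.Surjective ε →
      ∃ f : FundamentalGroup Y y →* E, ε.comp f = π := fun P E _ _ _ _ π ε hε =>
    exists_monoidHom_comp_eq_of_sameFiniteQuotients_freeGroup hQ' π ε hε
  rcases stub_kneserMilnorRetract Y hY y with ⟨r, hr⟩ | ⟨B, _, hB, hkind, ρ, s, hρs⟩
  · exact (hr.of_sameFiniteQuotients hQ').of_mulEquiv e
  · exfalso
    have hBlift := lift_of_retract ρ s hρs hlift
    rcases hkind with hfin | ⟨Z, _, _, _, _, _, _, _, hZ, z, hasph, ⟨eB⟩⟩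
    · haveI := hfin
      haveI := subsingleton_of_finite_of_lift hBlift
      exact not_nontrivial B hB
    · exact stub_asphericalNotLift Z hZ z hasph (lift_of_mulEquiv eB hBlift)

end Summit.SmoothPoincare4.SmoothPoincare4.Theorems.HeegaardPairFreenessDetection.Sieve

end
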